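import Mathlib
import Literature.Analysis.Calculus.ExpLocalLieSubalgebra
import HarnessLib

/-!
# Crux `ExtremalSpiralSymmetry` (stmt-NavierStokesRegularity-8215), line `registered`, stub 3c-ii
# `stub_symmetryFamily`: the differentiable one-parameter family of rigid scaling symmetries

Support file (theorems only, `--supports stmt-NavierStokesRegularity-8215`; no definitions — `Aff(…)`, `Stab(…)`, `𝕍`
are file-local notations, identical to the skeleton's). Lead c1.

Granted (i) the closed-subgroup character lemma (stub 3a, landed as
`…Registered.stub_closedSubgroupCharacter`, quoted here as the first hypothesis) and (ii) the closed-group facts about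
the stabiliser image `Stab(u) ⊆ 𝕍 = End(ℝ³ × ℝ) × ℝ × ℝ` (stub 3c-i, quoted as hypotheses), a field `u` whose parabolic
rescalings `S_c u` for every factor `c` near `1` are rigid motions of `u` on `t < 0` — with NO regularity of
`c ↦ (b, R)` — carries a differentiable family `s ↦ (c s, R s, b s)` of exact symmetries
`c s • u ((c s)² t, c s • x) = R s (u t (Q s (x - b s)))`, `Q s = (R s)⁻¹`, through the identity, with `ċ(0) = 1` and
skew `Ṙ(0)`. Proof: the dilation `ℓ = pr₂` is a character of `Stab(u)` whose values cover `(1 - δ, 1 + δ)`; stub 3a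
gives `X ∈ 𝕍` with `ℓ X = 1` and `exp(sX) ∈ Stab(u)` for all `s`; the components of `exp(sX)` are the family, their
derivatives at `0` are the components of `X`, `Q s = R(-s)` because `exp(-sX) exp(sX) = 1`, and `Ṙ(0)` is skew because
each `R s` is an isometry.
-/

noncomputable section

-- the summit and its single sub-problem share the name (CONVENTIONS §1), as in every Theorems file
set_option linter.dupNamespace false

open NormedSpace Filter Topology Set

namespace Summit.NavierStokesRegularity.NavierStokesRegularity.Theorems.ExtremalSpiralSymmetry.Registered

/-- Local notation for physical space `ℝ³`. -/
local notation "E3" => EuclideanSpace ℝ (Fin 3)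

/-- The ambient algebra `End(ℝ³ × ℝ) × ℝ × ℝ`. -/
local notation "𝕍" => ((EuclideanSpace ℝ (Fin 3) × ℝ) →L[ℝ] (EuclideanSpace ℝ (Fin 3) × ℝ)) × ℝ × ℝ

/-- `Aff(c, R, d)` : the linear map `(y, r) ↦ (c • R y + r • d, r)` of `ℝ³ × ℝ`. -/
local notation "Aff(" c ", " R ", " d ")" =>
  (ContinuousLinearMap.prod
    (ContinuousLinearMap.comp ((c : ℝ) • (R : EuclideanSpace ℝ (Fin 3) →L[ℝ] EuclideanSpace ℝ (Fin 3)))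
        (ContinuousLinearMap.fst ℝ (EuclideanSpace ℝ (Fin 3)) ℝ) +
      ContinuousLinearMap.smulRight (ContinuousLinearMap.snd ℝ (EuclideanSpace ℝ (Fin 3)) ℝ)
        (d : EuclideanSpace ℝ (Fin 3)))
    (ContinuousLinearMap.snd ℝ (EuclideanSpace ℝ (Fin 3)) ℝ))

-- `quotPrecheck` cannot look under the binders of this notation (it is a plain macro; nothing is hidden)
set_option quotPrecheck false in
/-- `Stab(u)` : the image in `𝕍` of the group of rigid parabolic scaling symmetries of `u` on `t < 0`. -/
local notation "Stab(" u ")" =>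
  (setOf fun M : 𝕍 =>
    ∃ (c : ℝ) (R : EuclideanSpace ℝ (Fin 3) ≃ₗᵢ[ℝ] EuclideanSpace ℝ (Fin 3)) (b : EuclideanSpace ℝ (Fin 3)),
      0 < c ∧ M = (Aff(c, (R : EuclideanSpace ℝ (Fin 3) →L[ℝ] EuclideanSpace ℝ (Fin 3)), c • b), c, c⁻¹) ∧
      ∀ t < (0:ℝ), ∀ x, c • u (c ^ 2 * t) (c • x) = R (u t (LinearIsometryEquiv.symm R (x - b))))

/-- Evaluation of `Aff(c, R, d)` (private copy of the sibling file's `aff_apply`). [folklore] -/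
private theorem aff_apply₂ (c : ℝ) (R : E3 →L[ℝ] E3) (d : E3) (y : E3) (r : ℝ) :
    Aff(c, R, d) (y, r) = (c • R y + r • d, r) := by
  simp

/-! ### Small calculus lemmas (kept separate: each declaration has its own heartbeat budget) -/

section Calculus

variable {G : Type*} [NormedAddCommGroup G] [NormedSpace ℝ G]

/-- `d/ds (c s)⁻¹ = -1` at `s = 0` when `c 0 = 1`, `ċ(0) = 1`. [folklore] -/
theorem hasDerivAt_inv_of_one {c : ℝ → ℝ} (hc : HasDerivAt c 1 0) (hc0 : c 0 = 1) :
    HasDerivAt (fun s => (c s)⁻¹) (-1) 0 := by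
  have h := hc.inv (by rw [hc0]; exact one_ne_zero)
  rw [hc0, one_pow, div_one] at h
  exact h

/-- Derivative at `0` of `s ↦ (c s)⁻¹ • F s` when `c 0 = 1`, `ċ(0) = 1`. [folklore] -/
theorem hasDerivAt_inv_smul {c : ℝ → ℝ} (hc : HasDerivAt c 1 0) (hc0 : c 0 = 1) {F : ℝ → G} {F' : G}
    (hF : HasDerivAt F F' 0) : HasDerivAt (fun s => (c s)⁻¹ • F s) (F' - F 0) 0 := by
  refine ((hasDerivAt_inv_of_one hc hc0).smul hF).congr_deriv ?_
  rw [hc0, inv_one, one_smul, neg_one_smul, sub_eq_add_neg]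

/-- Derivative at `0` of `s ↦ F (-s)`. [folklore] -/
theorem hasDerivAt_comp_neg' {F : ℝ → G} {F' : G} (hF : HasDerivAt F F' 0) :
    HasDerivAt (fun s => F (-s)) (-F') 0 := by
  have hF' : HasDerivAt F F' (-0) := by rw [neg_zero]; exact hF
  exact (hF'.scomp (0 : ℝ) (hasDerivAt_neg' (0 : ℝ))).congr_deriv (neg_one_smul ℝ F')

/-- The rotation block and the translation column of a differentiable family of endomorphisms of `ℝ³ × ℝ`
are differentiable, with the expected derivatives. [folklore] -/
theorem hasDerivAt_block_and_column {P : ℝ → ((E3 × ℝ) →L[ℝ] (E3 × ℝ))} {P' : (E3 × ℝ) →L[ℝ] (E3 × ℝ)}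
    (hP : HasDerivAt P P' 0) :
    HasDerivAt (fun s => (ContinuousLinearMap.fst ℝ E3 ℝ).comp ((P s).comp (ContinuousLinearMap.inl ℝ E3 ℝ)))
        ((ContinuousLinearMap.fst ℝ E3 ℝ).comp (P'.comp (ContinuousLinearMap.inl ℝ E3 ℝ))) 0 ∧
      HasDerivAt (fun s => ((P s) ((0 : E3), (1 : ℝ))).1) (P' ((0 : E3), (1 : ℝ))).1 0 := by
  constructor
  · have h1 := hP.clm_comp (hasDerivAt_const (0 : ℝ) (ContinuousLinearMap.inl ℝ E3 ℝ))
    have h2 := (hasDerivAt_const (0 : ℝ) (ContinuousLinearMap.fst ℝ E3 ℝ)).clm_comp h1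
    refine h2.congr_deriv ?_
    rw [ContinuousLinearMap.comp_zero, add_zero, ContinuousLinearMap.zero_comp, zero_add]
  · have h := ((ContinuousLinearMap.fst ℝ E3 ℝ).comp
      (ContinuousLinearMap.apply ℝ (E3 × ℝ) ((0 : E3), (1 : ℝ)))).hasFDerivAt.comp_hasDerivAt (0 : ℝ) hP
    simp only [Function.comp_def, ContinuousLinearMap.comp_apply, ContinuousLinearMap.apply_apply,
      ContinuousLinearMap.coe_fst'] at h
    exact h

/-- The components of the one-parameter group `s ↦ exp (s • X)` in `𝕍` are differentiable at `0` with
derivative the components of `X`. [folklore] -/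
theorem hasDerivAt_exp_smul_components (X : 𝕍) :
    HasDerivAt (fun s : ℝ => (exp (s • X)).1) X.1 0 ∧ HasDerivAt (fun s : ℝ => (exp (s • X)).2.1) X.2.1 0 := by
  have hexpd : HasDerivAt (fun s : ℝ => exp (s • X)) X 0 := by
    have h := hasDerivAt_exp_smul_const (𝕂 := ℝ) X (0 : ℝ)
    rw [zero_smul ℝ X, exp_zero, one_mul] at h
    exact h
  constructor
  · have h := (ContinuousLinearMap.fst ℝ ((E3 × ℝ) →L[ℝ] (E3 × ℝ)) (ℝ × ℝ)).hasFDerivAt.comp_hasDerivAt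
      (0 : ℝ) hexpd
    simp only [Function.comp_def, ContinuousLinearMap.coe_fst'] at h
    exact h
  · have h := ((ContinuousLinearMap.fst ℝ ℝ ℝ).comp
      (ContinuousLinearMap.snd ℝ ((E3 × ℝ) →L[ℝ] (E3 × ℝ)) (ℝ × ℝ))).hasFDerivAt.comp_hasDerivAt (0 : ℝ) hexpd
    simp only [Function.comp_def, ContinuousLinearMap.comp_apply, ContinuousLinearMap.coe_fst',
      ContinuousLinearMap.coe_snd'] at h
    exact h

/-- A differentiable family of isometries through the identity has a skew derivative. [folklore] -/
theorem inner_deriv_self_eq_zero_of_isometry {Rf : ℝ → (E3 →L[ℝ] E3)} {A : E3 →L[ℝ] E3}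
    (hR : HasDerivAt Rf A 0) (hR0 : Rf 0 = ContinuousLinearMap.id ℝ E3) (hiso : ∀ s y, ‖Rf s y‖ = ‖y‖)
    (y : E3) : inner ℝ (A y) y = 0 := by
  have hf : HasDerivAt (fun s => Rf s y) (A y) 0 := by
    refine (hR.clm_apply (hasDerivAt_const (0 : ℝ) y)).congr_deriv ?_
    rw [map_zero, add_zero]
  have hg := hf.inner ℝ hf
  have hconst : (fun s => inner ℝ (Rf s y) (Rf s y)) = fun _ => ‖y‖ ^ 2 := funext fun s => by
    rw [real_inner_self_eq_norm_sq, hiso]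
  rw [hconst] at hg
  have h0 := (hasDerivAt_const (0 : ℝ) (‖y‖ ^ 2)).unique hg
  rw [hR0, ContinuousLinearMap.id_apply, real_inner_comm] at h0
  linarith

end Calculus

/-! ### The components of a one-parameter subgroup of `Stab(u)` -/

section OneParam

variable (X : 𝕍) {c : ℝ → ℝ} {R : ℝ → (E3 ≃ₗᵢ[ℝ] E3)} {b : ℝ → E3}

/-- The dilation factor along `exp(sX)`: `c 0 = 1` and `ċ(0) = X.2.1 = 1`. [folklore] -/
theorem dilation_hasDerivAt (hc_eq : ∀ s, c s = (exp (s • X)).2.1) (hX : X.2.1 = 1) :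
    c 0 = 1 ∧ HasDerivAt c 1 0 := by
  obtain ⟨_, hd⟩ := hasDerivAt_exp_smul_components X
  have hc0 : c 0 = 1 := by
    rw [hc_eq, zero_smul ℝ X, exp_zero]
    rfl
  refine ⟨hc0, ?_⟩
  rw [hX] at hd
  exact hd.congr_of_eventuallyEq (Eventually.of_forall fun s => hc_eq s)

/-- The rotation block along `exp(sX)`: if the `ℝ³`-block of `(exp sX).1` is `c s • R s`, then `s ↦ R s` is
differentiable at `0` with derivative `(X.1)_block - id`, and `R 0 = id`. [folklore] -/
theorem rotation_hasDerivAt (hcpos : ∀ s, 0 < c s) (hc0 : c 0 = 1) (hc_d : HasDerivAt c 1 0)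
    (hB : ∀ s y, ((exp (s • X)).1 (y, 0)).1 = c s • R s y) :
    HasDerivAt (fun s => (R s : E3 →L[ℝ] E3))
        ((ContinuousLinearMap.fst ℝ E3 ℝ).comp (X.1.comp (ContinuousLinearMap.inl ℝ E3 ℝ)) -
          ContinuousLinearMap.id ℝ E3) 0 ∧
      (R 0 : E3 →L[ℝ] E3) = ContinuousLinearMap.id ℝ E3 := by
  obtain ⟨hP_d, _⟩ := hasDerivAt_exp_smul_components X
  obtain ⟨hB_d, _⟩ := hasDerivAt_block_and_column hP_d
  have hR_eq : ∀ s, (R s : E3 →L[ℝ] E3) = (c s)⁻¹ •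
      (ContinuousLinearMap.fst ℝ E3 ℝ).comp ((exp (s • X)).1.comp (ContinuousLinearMap.inl ℝ E3 ℝ)) :=
    fun s => by
    refine ContinuousLinearMap.ext fun y => ?_
    change R s y = (c s)⁻¹ • ((exp (s • X)).1 (y, 0)).1
    rw [hB, smul_smul, inv_mul_cancel₀ (hcpos s).ne', one_smul]
  have h0 : (ContinuousLinearMap.fst ℝ E3 ℝ).comp ((exp ((0 : ℝ) • X)).1.comp (ContinuousLinearMap.inl ℝ E3 ℝ))
      = ContinuousLinearMap.id ℝ E3 := by
    refine ContinuousLinearMap.ext fun y => ?_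
    change ((exp ((0 : ℝ) • X)).1 (y, 0)).1 = y
    rw [zero_smul ℝ X, exp_zero, Prod.fst_one]
    rfl
  constructor
  · rw [show (fun s => (R s : E3 →L[ℝ] E3)) = _ from funext hR_eq]
    refine (hasDerivAt_inv_smul hc_d hc0 hB_d).congr_deriv ?_
    rw [h0]
  · rw [hR_eq, hc0, inv_one, one_smul, h0]

/-- The rotations along `exp(sX)` invert under `s ↦ -s`, because `exp(-sX) exp(sX) = 1`. [folklore] -/
theorem rotation_neg_apply (hc_eq : ∀ s, c s = (exp (s • X)).2.1)
    (hB : ∀ s y, (exp (s • X)).1 (y, 0) = (c s • R s y, 0)) (s : ℝ) (z : E3) : R (-s) (R s z) = z := by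
  have hprod : exp ((-s) • X) * exp (s • X) = 1 := by
    rw [neg_smul s X]
    exact Literature.Analysis.Calculus.exp_neg_mul_exp (s • X)
  have h2c : c (-s) * c s = 1 := by
    have h := congrArg (fun M : 𝕍 => M.2.1) hprod
    simp only [Prod.snd_mul, Prod.fst_mul, Prod.snd_one, Prod.fst_one] at h
    rwa [← hc_eq, ← hc_eq] at h
  have h3 : ((exp ((-s) • X)).1 ((exp (s • X)).1 (z, 0))).1 = z :=
    congrArg (fun M : 𝕍 => (M.1 (z, 0)).1) hprod
  rw [hB, hB] at h3
  change c (-s) • R (-s) (c s • R s z) = z at h3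
  rwa [map_smul, smul_smul, h2c, one_smul] at h3

/-- The translation along `exp(sX)`: if the translation column of `(exp sX).1` is `c s • b s`, then
`b 0 = 0` and `ḃ(0) = (X.1 (0, 1)).1`. [folklore] -/
theorem translation_hasDerivAt (hcpos : ∀ s, 0 < c s) (hc0 : c 0 = 1) (hc_d : HasDerivAt c 1 0)
    (hT : ∀ s, ((exp (s • X)).1 ((0 : E3), (1 : ℝ))).1 = c s • b s) :
    b 0 = 0 ∧ HasDerivAt b (X.1 ((0 : E3), (1 : ℝ))).1 0 := by
  obtain ⟨hP_d, _⟩ := hasDerivAt_exp_smul_components X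
  obtain ⟨_, hT_d⟩ := hasDerivAt_block_and_column hP_d
  have hT0 : ((exp ((0 : ℝ) • X)).1 ((0 : E3), (1 : ℝ))).1 = 0 := by
    rw [zero_smul ℝ X, exp_zero, Prod.fst_one]
    rfl
  have hb_eq : ∀ s, b s = (c s)⁻¹ • ((exp (s • X)).1 ((0 : E3), (1 : ℝ))).1 := fun s => by
    rw [hT, smul_smul, inv_mul_cancel₀ (hcpos s).ne', one_smul]
  constructor
  · rw [hb_eq, hc0, inv_one, one_smul, hT0]
  · rw [show b = _ from funext hb_eq]
    refine (hasDerivAt_inv_smul hc_d hc0 hT_d).congr_deriv ?_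
    rw [hT0, sub_zero]

end OneParam


/-- **stub 3c-ii of line `registered` (crux `ExtremalSpiralSymmetry`, stmt-NavierStokesRegularity-8215).** See the
module docstring. -/
theorem stub_symmetryFamily :
    (∀ {𝔸 : Type} [NormedRing 𝔸] [NormedAlgebra ℚ 𝔸] [NormedAlgebra ℝ 𝔸] [CompleteSpace 𝔸]
      [FiniteDimensional ℝ 𝔸] (H : Set 𝔸) (ℓ : 𝔸 →L[ℝ] ℝ),
      IsClosed H → (1 : 𝔸) ∈ H → (∀ a ∈ H, ∀ b ∈ H, a * b ∈ H) → (∀ a ∈ H, ∃ b ∈ H, b * a = 1) →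
      (∀ a ∈ H, ∀ b ∈ H, ℓ (a * b) = ℓ a * ℓ b) →
      (∃ δ : ℝ, 0 < δ ∧ Set.Ioo (1 - δ) (1 + δ) ⊆ ℓ '' H) →
      ∃ X : 𝔸, ℓ X = 1 ∧ ∀ t : ℝ, NormedSpace.exp (t • X) ∈ H) →
    ∀ (u : ℝ → E3 → E3), IsClosed Stab(u) → (1 : 𝕍) ∈ Stab(u) →
      (∀ M ∈ Stab(u), ∀ M' ∈ Stab(u), M * M' ∈ Stab(u)) → (∀ M ∈ Stab(u), ∃ N ∈ Stab(u), N * M = 1) →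
      (∃ δ₀ : ℝ, 0 < δ₀ ∧ ∀ c : ℝ, |c - 1| < δ₀ →
        ∃ (b : E3) (R : E3 ≃ₗᵢ[ℝ] E3),
          ∀ t < 0, ∀ x, c • u (c ^ 2 * t) (c • x) = R (u t (R.symm (x - b)))) →
      ∃ (c : ℝ → ℝ) (b : ℝ → E3) (R Q : ℝ → (E3 →L[ℝ] E3)) (a : E3) (A : E3 →L[ℝ] E3),
        c 0 = 1 ∧ b 0 = 0 ∧ R 0 = ContinuousLinearMap.id ℝ E3 ∧ Q 0 = ContinuousLinearMap.id ℝ E3 ∧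
        HasDerivAt c 1 0 ∧ HasDerivAt b a 0 ∧ HasDerivAt R A 0 ∧ HasDerivAt Q (-A) 0 ∧
        (∀ x, inner ℝ (A x) x = 0) ∧
        ∀ s : ℝ, ∀ t < 0, ∀ x, c s • u (c s ^ 2 * t) (c s • x) = R s (u t (Q s (x - b s))) := by
  intro h3a u hcl h1 hmul hinv hloc
  obtain ⟨δ₀, hδ₀, hloc⟩ := hloc
  -- the dilation character `ℓ = pr₂`
  obtain ⟨ℓ, hℓdef⟩ : ∃ ℓ : 𝕍 →L[ℝ] ℝ, ℓ = (ContinuousLinearMap.fst ℝ ℝ ℝ).comp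
      (ContinuousLinearMap.snd ℝ ((E3 × ℝ) →L[ℝ] (E3 × ℝ)) (ℝ × ℝ)) := ⟨_, rfl⟩
  have hℓ : ∀ M : 𝕍, ℓ M = M.2.1 := fun M => by rw [hℓdef]; rfl
  have hchar : ∀ a ∈ Stab(u), ∀ b ∈ Stab(u), ℓ (a * b) = ℓ a * ℓ b := fun a _ b _ => by
    rw [hℓ, hℓ, hℓ, Prod.snd_mul, Prod.fst_mul]
  have hcov : ∃ δ : ℝ, 0 < δ ∧ Set.Ioo (1 - δ) (1 + δ) ⊆ ℓ '' Stab(u) := by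
    refine ⟨min δ₀ (1 / 2), lt_min hδ₀ (by norm_num), fun c' hc' => ?_⟩
    obtain ⟨hlo, hhi⟩ := hc'
    have hm1 := min_le_left δ₀ (1 / 2)
    have hm2 := min_le_right δ₀ (1 / 2)
    have h1' : |c' - 1| < δ₀ := by
      rw [abs_lt]; constructor <;> linarith
    have hc'pos : 0 < c' := by linarith
    obtain ⟨b', R', hsym'⟩ := hloc c' h1'
    exact ⟨(Aff(c', (R' : E3 →L[ℝ] E3), c' • b'), c', c'⁻¹), ⟨c', R', b', hc'pos, rfl, hsym'⟩, hℓ _⟩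
  obtain ⟨X, hXℓ, hX⟩ : ∃ X : 𝕍, ℓ X = 1 ∧ ∀ t : ℝ, exp (t • X) ∈ Stab(u) := by
    letI : NormedAlgebra ℚ 𝕍 := NormedAlgebra.restrictScalars ℚ ℝ 𝕍
    exact h3a Stab(u) ℓ hcl h1 hmul hinv hchar hcov
  rw [hℓ] at hXℓ
  -- the data `(c s, R s, b s)` of the one-parameter subgroup `s ↦ exp (s • X) ∈ Stab(u)`
  choose c R b hcpos hM hsym using hX
  have hc_eq : ∀ s, c s = (exp (s • X)).2.1 := fun s => by rw [hM s]
  -- `hP_eq s : (exp (s • X)).1 = Aff(c s, R s, c s • b s)` (stated by unification, not by re-elaboration)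
  have hP_eq := fun s => congrArg Prod.fst (hM s)
  dsimp only at hP_eq
  have hB' : ∀ s y, (exp (s • X)).1 (y, 0) = (c s • R s y, 0) := fun s y => by
    rw [hP_eq s, aff_apply₂, zero_smul, add_zero]
    rfl
  have hB : ∀ s y, ((exp (s • X)).1 (y, 0)).1 = c s • R s y := fun s y => by
    rw [hB']
  have hT : ∀ s, ((exp (s • X)).1 ((0 : E3), (1 : ℝ))).1 = c s • b s := fun s => by
    rw [hP_eq s, aff_apply₂, map_zero, smul_zero, zero_add, one_smul]
  -- the components and their derivatives at `0`
  obtain ⟨hc0, hc_d⟩ := dilation_hasDerivAt X hc_eq hXℓ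
  obtain ⟨hR_d, hR0⟩ := rotation_hasDerivAt X hcpos hc0 hc_d hB
  obtain ⟨hb0, hb_d⟩ := translation_hasDerivAt X hcpos hc0 hc_d hT
  -- the inverse rotations `Q s = (R s)⁻¹ = R (-s)`
  have hQ_eq : ∀ s, ((R s).symm : E3 →L[ℝ] E3) = (R (-s) : E3 →L[ℝ] E3) := fun s => by
    refine ContinuousLinearMap.ext fun y => ?_
    have h := rotation_neg_apply X hc_eq hB' s ((R s).symm y)
    rw [LinearIsometryEquiv.apply_symm_apply] at h
    change (R s).symm y = R (-s) y
    exact h.symm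
  have hQ_d : HasDerivAt (fun s => ((R s).symm : E3 →L[ℝ] E3))
      (-((ContinuousLinearMap.fst ℝ E3 ℝ).comp (X.1.comp (ContinuousLinearMap.inl ℝ E3 ℝ)) -
        ContinuousLinearMap.id ℝ E3)) 0 := by
    rw [show (fun s => ((R s).symm : E3 →L[ℝ] E3)) = fun s => (R (-s) : E3 →L[ℝ] E3) from funext hQ_eq]
    exact hasDerivAt_comp_neg' hR_d
  have hQ0 : ((R 0).symm : E3 →L[ℝ] E3) = ContinuousLinearMap.id ℝ E3 := by
    rw [hQ_eq, neg_zero, hR0]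
  -- skewness of `Ṙ(0)`: each `R s` is an isometry
  have hskew := inner_deriv_self_eq_zero_of_isometry hR_d hR0 fun s y => (R s).norm_map y
  -- assemble
  exact ⟨c, b, fun s => (R s : E3 →L[ℝ] E3), fun s => ((R s).symm : E3 →L[ℝ] E3), (X.1 ((0 : E3), (1 : ℝ))).1,
    _, hc0, hb0, hR0, hQ0, hc_d, hb_d, hR_d, hQ_d, hskew, fun s t ht x => hsym s t ht x⟩

end Summit.NavierStokesRegularity.NavierStokesRegularity.Theorems.ExtremalSpiralSymmetry.Registered

end
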